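import Literature.MathematicalPhysics.QuantumFieldTheory.Balaban1983to89.T4CoReadMoment

/-!
# `Balaban1983to89.T4PairDecorrelation` — the cross-pair DECORRELATION clause NE1(ii)-DECORR (= located obligation O-G8)
of row T4-O3.E-ii TYPED as a hypothesis shape, with its kernel bookkeeping: an ℓ¹–ℓ^∞ (Schur) covariance budget turns
the second moment of a SUM of pair pieces into `C_dec ×` the DIAGONAL variance line of `T4CoReadMoment` (K11a)
(cell `pub-balaban`, T4-DAG v6 §5 row T4-O3.E-ii, self-proposed starred sub-row T4-O3.E-ii-DECORR* of the pv18 lineage;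
a LEAF importing `T4CoReadMoment` only; Mathlib + that module BY NAME; every declaration [folklore])

HONEST FRAMING (cell `pub-balaban`, T4-DAG PAGE 1).  The cell's T4 target is the existence AND uniqueness of the continuum
limit of Bałaban's unit-scale averaged loop expectations on a finite torus — a constructive-QFT statement strictly beyond
ultraviolet stability ([Balaban1989LargeFieldII] Thm 1 p. 355); it is NOT the Yang–Mills mass gap, NOT infinite volume and
NOT the Clay problem.  This module is kernel bookkeeping for ONE located clause of ONE `EST` row (T4-O3.E-ii, paper half
`t4/T4-EST-O3Eii.md` §4 «NE1(ii)-DECORR»): it TYPES the clause as a `Prop`-valued hypothesis shape and proves what the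
shape buys and what it costs.  It asserts NOTHING about Bałaban's papers: no estimate of the series B1–B16 is quoted as a
fact, used or typed; the clause itself is NOT estimated for Bałaban's conditional laws (that estimate is OPEN and has no
printed locus for observable insertions, see LOCATED ITEMS).  Value = a typed hypothesis shape + kernel arithmetic (where
exactly a decorrelation budget enters the second-cumulant booking of a cube-family of pair pieces, with which constants,
and what the budget is WITHOUT any decorrelation); NOT summit progress, NOT the cell's estimate NE1′.

CITATION HEADER (lean-in-tree rule 2026-08-18).  This seat (pv18 lineage gen 6) re-read the RENDERS
`b2b-balaban-ref1/pages/1988-cmp116-rg-II-cluster/1988-cmp116-rg-II-cluster-p020-x2.png` (journal p. 20) and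
`-p021-x2.png` (p. 21) of T. Bałaban, *Renormalization group approach to lattice gauge field theories. II. Cluster
expansions*, Commun. Math. Phys. **116** (1988) 1–22 [Balaban1988RG2Cluster] (cell paper B13; journal page = PDF page),
as images, and quotes VERBATIM, for CONTEXT ONLY: p. 20 «Lemma 3. Under all the above restrictions on the constants
M, κ, κ₁, α₀, α₁, α₄, α₆, γ₂, γ, ε₁, the activity H(Z) for a localization domain Z∈D_{k+1} satisfies the inequality
|H(Z)| ≤ C₃ε₁ exp(−(1 − 8δ)½Lκd_{k+1}(Z)). (2.38)» and «The above lemma implies that sufficient conditions for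
convergence of the series (2.12), (2.13) are satisfied, see [26, 67, 25, 50].»; p. 21 «To the above sum we can repeat all
the considerations and bounds of the paper [26], for κ sufficiently large, and ε₁ sufficiently small. We obtain» … and
«|E^{(k+1)}(X)| ≤ O(1)C₃ε₁ exp(−(1 − 10δ)½Lκd_{k+1}(X)). (2.41)»; display (2.39) on p. 21 bounds |E^{(k+1)}(X)| by a sum
over families (Z₁, …, Z_n) with ∪Z_i = X of the truncated functions |ρ^T(Z₁, …, Z_n)| times the activities.  WHY THESE
LINES: they are the printed TREE DECAY of the scale-`k` cluster expansion — activities of localization domains decay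
exponentially in the scaled size `d_{k+1}`, and connected («truncated») parts are summed against that decay.  That is the
MECHANISM from which a decorrelation kernel `κ(p, q) ≲ e^{−c·dist(p,q)}` between SEPARATED pair pieces would come; it is
printed for the ACTIVITIES of the expansion of the effective action, and NOWHERE for covariances of observable / pair
insertions under the conditional law (negative finding of `t4/T4-EST-O3Eii.md` §1 stands).  No disputed step of the
manuscripts is used; the quotations only LOCATE the clause.  Every `theorem` below is [folklore] (AM–GM, finite sums,
Cauchy–Schwarz, `exp`/`log` inequalities imported BY NAME from `T4CoReadMoment`).

THE CLAUSE SERVED (cell texts, verbatim excerpts; CELL ANALYSIS, located, NOT facts).  `t4/T4-EST-O3Eii.md` v1.6 §4: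
«NE1(ii)-DECORR [located, NEW obligation of this row = O-G8 / GAPS G-pv28g5-2, agreed 23:49:17Z]: cross-pair covariance
decoupling inside the second cumulant of a SUM of co-read pair pieces at one cube (shape «Var_u(Σ_p c_pℓ[B_p]) ≤ C_dec Σ_p
c_p² Var_u(ℓ[B_p])» or a covariance-summability clause from the scale-k tree decay); with it the diagonal VARIANCE LINE
(Λθ₁²)^{K−j} (`T4CoReadMoment.varianceLine_le`) is the bound, without it only the squared sup line; NOT typed (a `Prop` over
`T4TermFormat.Booking` pair data would be the natural home — successor option), NOT estimated, nothing printed.»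
`t4/T4-EST-O3Eiiib.md` v2 §5: «O-G8 (gen 5): the cross-pair terms of E_u V² in (M1)(ii) — Σ_{p≠p′} c_p c_p′ Cov_u(ℓ[B_p],
ℓ[B_p′]) — need the decay of the conditional covariance between separated pairs (the cluster expansion's tree decay at scale
k); with it the diagonal VARIANCE LINE is the bound (K11a), without it only the squared sup line. Located at B13 §2 S4/S5
(the same fluctuation-integral machinery as O-G2/O-G3); not typed.»  THIS MODULE TYPES IT — over plain measure-theoretic
data (a law, a finite family of real pieces), NOT over `T4TermFormat.Booking` (design choice: the clause is a property of
ONE conditional law and ONE cube-family; the `Booking` arrays only consume its OUTPUT, the per-cube second-cumulant budget,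
through `T4CoReadMoment.varianceLine_le` — (K12g) below makes that hand-over explicit).

DICTIONARY.  `μ` = a probability law on `Ω` (cell: the conditional law of the scale-`k` fluctuation field at a FIXED
exterior `u`, the `μ` of `T4CoReadMoment` (K10)); `s : Finset ι` = the pair pieces alive in one cube; `X p : Ω → ℝ` = the
CENTRED piece WITHOUT its amplitude (cell: `ℓ_u[B_b, B_b′] − E_u ℓ_u[B_b, B_b′]`); `c p` = its amplitude (cell: first-order
rate `θ₁^{K−j}` × background factor, row NE1ii-BIRTH's law); `σ p` = a second-moment scale of `X p` (`σ_p² = Var_u` in the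
record's wording; (K12k) takes `σ_p = ‖X_p‖_{L²(μ)}` literally); `κ p q` = the DECORRELATION KERNEL, `C` = the budget
`C_dec`; `lvl p ≤ k` = the birth level of the piece, `K` = the number of steps; `Λ, τ, r, N₀, A` as in
`T4CoReadMoment.varianceLine_le` (cell values `Λ = L⁴`, `τ = θ₁ = L⁻³`, `Λτ² = L⁻² ≤ r < 1`).

WHAT IS TYPED AND PROVED (all [folklore]; `lean check` rc 0, 0 sorry; standard axioms).
* §1 (K12a) SCHUR BUDGET `schur_sum_mul_le`: a kernel `κ ≥ 0` on `s × s` with all ROW and COLUMN sums `≤ C` gives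
  `Σ_{p,q} κ(p,q)|a_p||a_q| ≤ C·Σ_p a_p²` (AM–GM per entry; symmetric kernels need rows only, `schur_sum_mul_le_of_symm`);
  (K12b) `sum_mul_mul_le_of_abs_le`: entries `|M(p,q)| ≤ κ(p,q)σ_pσ_q` ⇒ `Σ_{p,q} c_pc_qM(p,q) ≤ C·Σ_p (c_pσ_p)²`.
* §2 LEVEL ARITHMETIC (no measure theory): (K12g₀) `sum_le_sum_card_fiber_mul` regroups a sum over pieces by a level map
  into `Σ_j #(fibre j)·g j`; (K12g) `cubeBudget_le`: per-piece budgets `w p ≤ A(τ²)^{K−lvl p}` and fibre counts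
  `#{p : lvl p = j} ≤ N₀Λ^{k−j}` give `Σ_p w p ≤ N₀A/(1−r)` under `Λτ² ≤ r < 1` — `T4CoReadMoment.varianceLine_le` BY NAME;
  (K12h) `rowSum_le_of_shellCount` / `shellSum_le_of_geom` / `rowSum_le_of_treeDecay`: a kernel dominated by a decay
  profile in a separation, `κ(p,q) ≤ A·θ^{dist p q}`, with shell counts `#{q : dist p q = n} ≤ G₀Γⁿ` and `Γθ ≤ ρ < 1`, has
  row sums `≤ A·G₀/(1−ρ)` — INDEPENDENT of `#s`: the arithmetic by which tree decay would discharge the clause.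
* §3 (K12c) THE SHAPE `PairDecorrelation μ s X σ κ C` (a `structure … : Prop`): `σ ≥ 0`, `κ ≥ 0` on `s`,
  `|∫ X_p X_q dμ| ≤ κ(p,q)·σ_p·σ_q`, row sums and column sums of `κ` over `s` `≤ C`; with `budget_nonneg`, `mono`,
  `of_symm`, `subset`.  (K12d) `integral_sq_sum_le`: `∫ (Σ_p c_pX_p)² dμ ≤ C·Σ_p (c_pσ_p)²` for ALL amplitudes — the
  record's display with `C = C_dec`.  (K12f) `log_integral_exp_neg_sum_bounds`: for bounded measurable CENTRED pieces
  (`|X_p| ≤ b_p`, `∫X_p = 0`) and `Σ_p |c_p|b_p ≤ 1`, `0 ≤ log ∫ exp(−Σ_p c_pX_p) dμ ≤ C·Σ_p (c_pσ_p)²`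
  (`T4CoReadMoment.log_integral_exp_neg_nonneg` / `…_le_sq` (K10) + (K12d)); (K12g′) `log_integral_exp_neg_sum_le_line`:
  with second-moment budgets `(c_pσ_p)² ≤ A(τ²)^{K−lvl p}` and the positional counts, the whole cube-family moves the
  effective action by at most `C·N₀A/(1−r)`, K-UNIFORMLY — the diagonal variance line times the decorrelation budget.
* §4 CALIBRATION (what the shape is WITHOUT decorrelation): (K12i) `of_sup` — for `|X_p| ≤ b_p` on a probability space the
  shape ALWAYS holds with `κ ≡ 1`, `σ = b`, `C = #s` (the SQUARED SUP LINE: `∫(Σ c_pX_p)² ≤ #s·Σ(c_pb_p)²`); (K12j)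
  `of_uncorrelated` — pairwise-orthogonal pieces give `κ = δ_{pq}`, `C = 1`; (K12k) `of_cauchySchwarz` — bounded strongly
  measurable pieces on a finite measure satisfy the shape with the LITERAL scales `σ_p = √∫X_p²`, `κ ≡ 1`, `C = #s` (kernel
  Cauchy–Schwarz `abs_integral_mul_le_sqrt_mul_sqrt`, discriminant proof).  So the clause's entire CONTENT for the cell is a budget `C` that does not grow with the number of
  pairs in a cube (`#s ~ N₀Σ_jΛ^{k−j}` grows without bound in `K`), i.e. summable decay of `κ` in the separation — (K12h).

READINGS (analysis on the typed shapes; CELL ANALYSIS where it speaks of the cell).  (1) The clause is consumed ONLY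
through (K12d): whoever books the cube-family's second cumulant by the variance line (row O3.E-iii-b's (M1)(ii),
`T4PreservedUnderT`; row O3.E-ii's §0 (j) two-body step at second order) needs exactly `∫(Σc_pX_p)² ≤ C_dec·Σ(c_pσ_p)²`,
nothing about individual covariances; the kernel `κ` is the natural CERTIFICATE for it (Schur), not an extra demand.
(2) The row-AND-column budget (not rows only) is what a non-symmetric domination needs; covariance kernels are symmetric
and then `of_symm` halves the obligation.  (3) The Schur budget is the SECOND-MOMENT twin of the kernel budget
`Σ_{b′} v b b′ k·u b′ ≤ V` of the first-order Mayer gate `T4GatedBooking.mayerSmallAt_of_sizeBoundAt` (same ℓ¹–ℓ^∞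
pattern, different currency); neither implies the other.  (4) (K12h) needs BOTH a decay rate `θ` per unit of separation
AND a shell-growth rate `Γ` with `Γθ < 1`; polynomial shell growth (pairs at scaled distance `n` inside a cube) fits
`G₀Γⁿ` for every `Γ > 1` at the price of `G₀ = G₀(Γ)`, so any exponential tree decay suffices — but a decay that is only
summable against the WRONG dimension's shell count does not, and the module does not pretend otherwise.  (5) Centring
and the amplitude normalisation `Σ|c_p|b_p ≤ 1` of (K12f) are the hypotheses of (K10) verbatim; general amplitudes
rescale, uncentred pieces are centred at the cost `b ↦ 2b` and a carried mean (row O3.E-iii-b (M1)(i), NE1(ii)-MEAN) —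
not repeated here.

LOCATED ITEMS NOT TOUCHED (cell obligations; none printed, none kernel): the INSTANCE of `PairDecorrelation` for
Bałaban's conditional fluctuation laws with a `K`-uniform `C_dec` (= the estimate NE1(ii)-DECORR / O-G8 proper: decay of
conditional covariances of separated pair insertions from the scale-`k` tree decay, loci B13 §2 (2.38)–(2.41) for
activities only); the conditional-mean budget NE1(ii)-MEAN / O-G7; the pair shape `LoopPairOscBoundSep` and its one-step
laws (row NE1ii-BIRTH); the multi-step polymer format (rows O3.E-iii-a/b/c); `s`-body pieces, `s ≥ 3`.
-/

noncomputable section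

open MeasureTheory Finset
open scoped BigOperators

namespace Literature.MathematicalPhysics.QuantumFieldTheory.Balaban1983to89.T4PairDecorrelation

open Literature.MathematicalPhysics.QuantumFieldTheory.Balaban1983to89.T4CoReadMoment

/-! ## §1 (K12a/b) The Schur budget: a nonnegative kernel with bounded row and column sums -/

section Schur

variable {ι : Type*}

/-- AM–GM for two absolute values: `|a|·|b| ≤ a²/2 + b²/2`. [folklore] -/
theorem abs_mul_abs_le (a b : ℝ) : |a| * |b| ≤ a ^ 2 / 2 + b ^ 2 / 2 := by
  have h := two_mul_le_add_sq |a| |b|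
  rw [sq_abs, sq_abs] at h
  linarith

/-- **(K12a) SCHUR TEST, quadratic-form version.**  A kernel `κ ≥ 0` on `s × s` whose ROW sums and COLUMN sums over `s`
are all `≤ C` satisfies `Σ_{p,q ∈ s} κ(p,q)·|a_p|·|a_q| ≤ C·Σ_{p ∈ s} a_p²` for every real array `a` (AM–GM on each entry,
the row budget on the `a_p²` half, the column budget on the `a_q²` half). [folklore] -/
theorem schur_sum_mul_le (s : Finset ι) (κ : ι → ι → ℝ) (a : ι → ℝ) {C : ℝ}
    (hκ : ∀ p ∈ s, ∀ q ∈ s, 0 ≤ κ p q) (hrow : ∀ p ∈ s, ∑ q ∈ s, κ p q ≤ C)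
    (hcol : ∀ q ∈ s, ∑ p ∈ s, κ p q ≤ C) :
    ∑ p ∈ s, ∑ q ∈ s, κ p q * (|a p| * |a q|) ≤ C * ∑ p ∈ s, a p ^ 2 := by
  have h1 : ∑ p ∈ s, ∑ q ∈ s, κ p q * (a p ^ 2 / 2) ≤ ∑ p ∈ s, C * (a p ^ 2 / 2) := by
    refine sum_le_sum fun p hp => ?_
    rw [← sum_mul]
    exact mul_le_mul_of_nonneg_right (hrow p hp) (by positivity)
  have h2 : ∑ p ∈ s, ∑ q ∈ s, κ p q * (a q ^ 2 / 2) ≤ ∑ q ∈ s, C * (a q ^ 2 / 2) := by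
    rw [sum_comm]
    refine sum_le_sum fun q hq => ?_
    rw [← sum_mul]
    exact mul_le_mul_of_nonneg_right (hcol q hq) (by positivity)
  calc ∑ p ∈ s, ∑ q ∈ s, κ p q * (|a p| * |a q|)
      ≤ ∑ p ∈ s, ∑ q ∈ s, (κ p q * (a p ^ 2 / 2) + κ p q * (a q ^ 2 / 2)) :=
        sum_le_sum fun p hp => sum_le_sum fun q hq => by
          rw [← mul_add]
          exact mul_le_mul_of_nonneg_left (abs_mul_abs_le _ _) (hκ p hp q hq)
    _ = ∑ p ∈ s, ∑ q ∈ s, κ p q * (a p ^ 2 / 2) + ∑ p ∈ s, ∑ q ∈ s, κ p q * (a q ^ 2 / 2) := by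
        simp only [sum_add_distrib]
    _ ≤ ∑ p ∈ s, C * (a p ^ 2 / 2) + ∑ q ∈ s, C * (a q ^ 2 / 2) := add_le_add h1 h2
    _ = C * ∑ p ∈ s, a p ^ 2 := by rw [← mul_sum, ← sum_div]; ring

/-- (K12a′) For a SYMMETRIC kernel the column budget is the row budget. [folklore] -/
theorem schur_sum_mul_le_of_symm (s : Finset ι) (κ : ι → ι → ℝ) (a : ι → ℝ) {C : ℝ}
    (hκ : ∀ p ∈ s, ∀ q ∈ s, 0 ≤ κ p q) (hsymm : ∀ p ∈ s, ∀ q ∈ s, κ p q = κ q p)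
    (hrow : ∀ p ∈ s, ∑ q ∈ s, κ p q ≤ C) :
    ∑ p ∈ s, ∑ q ∈ s, κ p q * (|a p| * |a q|) ≤ C * ∑ p ∈ s, a p ^ 2 :=
  schur_sum_mul_le s κ a hκ hrow fun q hq =>
    (sum_congr rfl fun p hp => hsymm p hp q hq).trans_le (hrow q hq)

/-- **(K12b) SIGNED ENTRIES.**  If `|M(p,q)| ≤ κ(p,q)·σ_p·σ_q` on `s × s` (`σ ≥ 0`, `κ` as in (K12a)), then for all real
amplitudes `c`: `Σ_{p,q ∈ s} c_p c_q M(p,q) ≤ C·Σ_{p ∈ s} (c_p σ_p)²`.  This is the form in which a covariance matrix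
`M(p,q) = ∫ X_p X_q dμ` is consumed in (K12d). [folklore] -/
theorem sum_mul_mul_le_of_abs_le (s : Finset ι) (M κ : ι → ι → ℝ) (c σ : ι → ℝ) {C : ℝ}
    (hσ : ∀ p ∈ s, 0 ≤ σ p) (hκ : ∀ p ∈ s, ∀ q ∈ s, 0 ≤ κ p q)
    (hM : ∀ p ∈ s, ∀ q ∈ s, |M p q| ≤ κ p q * (σ p * σ q))
    (hrow : ∀ p ∈ s, ∑ q ∈ s, κ p q ≤ C) (hcol : ∀ q ∈ s, ∑ p ∈ s, κ p q ≤ C) :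
    ∑ p ∈ s, ∑ q ∈ s, c p * c q * M p q ≤ C * ∑ p ∈ s, (c p * σ p) ^ 2 :=
  calc ∑ p ∈ s, ∑ q ∈ s, c p * c q * M p q
      ≤ ∑ p ∈ s, ∑ q ∈ s, κ p q * (|c p * σ p| * |c q * σ q|) :=
        sum_le_sum fun p hp => sum_le_sum fun q hq => by
          calc c p * c q * M p q ≤ |c p * c q * M p q| := le_abs_self _
            _ = |c p| * |c q| * |M p q| := by rw [abs_mul, abs_mul]
            _ ≤ |c p| * |c q| * (κ p q * (σ p * σ q)) :=
                mul_le_mul_of_nonneg_left (hM p hp q hq) (by positivity)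
            _ = κ p q * (|c p * σ p| * |c q * σ q|) := by
                rw [abs_mul (c p), abs_mul (c q), abs_of_nonneg (hσ p hp), abs_of_nonneg (hσ q hq)]; ring
    _ ≤ C * ∑ p ∈ s, (c p * σ p) ^ 2 := schur_sum_mul_le s κ (fun p => c p * σ p) hκ hrow hcol

end Schur

/-! ## §2 (K12g/h) Level arithmetic: regrouping by birth level, the cube budget on the variance line, shell counts -/

section Levels

variable {ι : Type*}

/-- (K12g₀) REGROUPING BY A LEVEL MAP: if every `p ∈ s` has `lvl p ≤ k` and `f p ≤ g (lvl p)`, then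
`Σ_{p ∈ s} f p ≤ Σ_{j ≤ k} #{p ∈ s : lvl p = j}·g j`. [folklore] -/
theorem sum_le_sum_card_fiber_mul {s : Finset ι} (lvl : ι → ℕ) {k : ℕ} (hlvl : ∀ p ∈ s, lvl p ≤ k) (f : ι → ℝ)
    (g : ℕ → ℝ) (hfg : ∀ p ∈ s, f p ≤ g (lvl p)) :
    ∑ p ∈ s, f p ≤ ∑ j ∈ range (k + 1), ((s.filter fun p => lvl p = j).card : ℝ) * g j := by
  have hmaps : ∀ p ∈ s, lvl p ∈ range (k + 1) := fun p hp => mem_range.mpr (Nat.lt_succ_of_le (hlvl p hp))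
  rw [← sum_fiberwise_of_maps_to hmaps f]
  refine sum_le_sum fun j _ => ?_
  calc ∑ p ∈ s.filter (fun p => lvl p = j), f p ≤ ∑ p ∈ s.filter (fun p => lvl p = j), g j :=
        sum_le_sum fun p hp => by
          obtain ⟨hps, hpj⟩ := mem_filter.mp hp
          rw [← hpj]
          exact hfg p hps
    _ = ((s.filter fun p => lvl p = j).card : ℝ) * g j := by rw [sum_const, nsmul_eq_mul]

/-- **(K12g) THE CUBE BUDGET ON THE VARIANCE LINE.**  Pieces `p ∈ s` with birth levels `lvl p ≤ k ≤ K`, per-piece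
SECOND-MOMENT budgets `w p ≤ A·(τ²)^{K − lvl p}` (`A ≥ 0`, `0 ≤ τ ≤ 1`) and positional fibre counts
`#{p ∈ s : lvl p = j} ≤ N₀·Λ^{k−j}` (`N₀, Λ ≥ 0`) have `Σ_{p ∈ s} w p ≤ N₀A/(1−r)` as soon as `Λτ² ≤ r < 1` — uniformly in
`k`, `K` and `#s`.  This is `T4CoReadMoment.varianceLine_le` (K11a) BY NAME after the regrouping (K12g₀); cell values
`Λ = L⁴`, `τ = θ₁ = L⁻³`, `Λτ² = L⁻²`. [folklore] -/
theorem cubeBudget_le {s : Finset ι} (lvl : ι → ℕ) {N₀ A Λ τ r : ℝ} {K k : ℕ} (hk : k ≤ K)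
    (hlvl : ∀ p ∈ s, lvl p ≤ k)
    (hcard : ∀ j, j ≤ k → ((s.filter fun p => lvl p = j).card : ℝ) ≤ N₀ * Λ ^ (k - j))
    (hN₀ : 0 ≤ N₀) (hA : 0 ≤ A) (hΛ : 0 ≤ Λ) (hτ0 : 0 ≤ τ) (hτ1 : τ ≤ 1) (hr : Λ * τ ^ 2 ≤ r) (hr1 : r < 1)
    {w : ι → ℝ} (hw : ∀ p ∈ s, w p ≤ A * (τ ^ 2) ^ (K - lvl p)) :
    ∑ p ∈ s, w p ≤ N₀ * A / (1 - r) :=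
  (sum_le_sum_card_fiber_mul lvl hlvl w (fun j => A * (τ ^ 2) ^ (K - j)) hw).trans
    (varianceLine_le (N := fun j => ((s.filter fun p => lvl p = j).card : ℝ)) hk hcard hN₀ hA hΛ hτ0 hτ1 hr hr1)

/-- **(K12h) ROW BUDGET FROM A SHELL COUNT × DECAY PROFILE.**  A kernel row dominated by a decay profile in a separation,
`κ(p,q) ≤ A·δ(dist p q)` (`A, δ ≥ 0`), with all `q ∈ s` within separation `D` of `p` and shell counts
`#{q ∈ s : dist p q = n} ≤ G n`, has `Σ_{q ∈ s} κ(p,q) ≤ A·Σ_{n ≤ D} G n·δ n`.  ((K12g₀) with `lvl := dist p`.) [folklore] -/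
theorem rowSum_le_of_shellCount {s : Finset ι} (dist : ι → ι → ℕ) (κ : ι → ι → ℝ) (δ G : ℕ → ℝ) {A : ℝ} {D : ℕ}
    (p : ι) (hA : 0 ≤ A) (hδ : ∀ n, 0 ≤ δ n) (hκ : ∀ q ∈ s, κ p q ≤ A * δ (dist p q))
    (hD : ∀ q ∈ s, dist p q ≤ D) (hG : ∀ n, n ≤ D → ((s.filter fun q => dist p q = n).card : ℝ) ≤ G n) :
    ∑ q ∈ s, κ p q ≤ A * ∑ n ∈ range (D + 1), G n * δ n := by
  calc ∑ q ∈ s, κ p q ≤ ∑ n ∈ range (D + 1), ((s.filter fun q => dist p q = n).card : ℝ) * (A * δ n) :=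
        sum_le_sum_card_fiber_mul (dist p) hD (κ p) (fun n => A * δ n) hκ
    _ ≤ ∑ n ∈ range (D + 1), G n * (A * δ n) :=
        sum_le_sum fun n hn =>
          mul_le_mul_of_nonneg_right (hG n (Nat.lt_succ_iff.mp (mem_range.mp hn))) (mul_nonneg hA (hδ n))
    _ = A * ∑ n ∈ range (D + 1), G n * δ n := by
        rw [mul_sum]
        exact sum_congr rfl fun n _ => by ring

/-- (K12h′) GEOMETRIC SHELLS AGAINST GEOMETRIC DECAY: shell counts `G n ≤ G₀·Γⁿ` (`G₀, Γ ≥ 0`) against a decay `θⁿ`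
(`θ ≥ 0`) with a STRICT product `Γθ ≤ ρ < 1` give `Σ_{n ≤ D} G n·θⁿ ≤ G₀/(1−ρ)`, uniformly in `D`. [folklore] -/
theorem shellSum_le_of_geom {G : ℕ → ℝ} {G₀ Γ θ ρ : ℝ} (D : ℕ) (hG₀ : 0 ≤ G₀) (hΓ : 0 ≤ Γ) (hθ : 0 ≤ θ)
    (hG : ∀ n, n ≤ D → G n ≤ G₀ * Γ ^ n) (hρ : Γ * θ ≤ ρ) (hρ1 : ρ < 1) :
    ∑ n ∈ range (D + 1), G n * θ ^ n ≤ G₀ / (1 - ρ) := by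
  have hΓθ : 0 ≤ Γ * θ := mul_nonneg hΓ hθ
  have hρ0 : 0 ≤ ρ := hΓθ.trans hρ
  calc ∑ n ∈ range (D + 1), G n * θ ^ n ≤ ∑ n ∈ range (D + 1), G₀ * ρ ^ n :=
        sum_le_sum fun n hn => by
          calc G n * θ ^ n ≤ G₀ * Γ ^ n * θ ^ n :=
                mul_le_mul_of_nonneg_right (hG n (Nat.lt_succ_iff.mp (mem_range.mp hn))) (pow_nonneg hθ n)
            _ = G₀ * (Γ * θ) ^ n := by rw [mul_pow]; ring
            _ ≤ G₀ * ρ ^ n := mul_le_mul_of_nonneg_left (pow_le_pow_left₀ hΓθ hρ n) hG₀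
    _ = G₀ * ∑ n ∈ range (D + 1), ρ ^ n := by rw [mul_sum]
    _ ≤ G₀ * (1 / (1 - ρ)) := by
        refine mul_le_mul_of_nonneg_left ?_ hG₀
        have hgeom := geom_sum_Ico_le_of_lt_one (m := 0) (n := D + 1) hρ0 hρ1
        rw [pow_zero, Nat.Ico_zero_eq_range] at hgeom
        exact hgeom
    _ = G₀ / (1 - ρ) := by rw [mul_one_div]

/-- **(K12h″) THE TREE-DECAY INSTANCE OF THE ROW BUDGET**: `κ(p,q) ≤ A·θ^{dist p q}`, shell counts `≤ G₀Γⁿ` within the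
range `D`, and `Γθ ≤ ρ < 1` give `Σ_{q ∈ s} κ(p,q) ≤ A·G₀/(1−ρ)` — a budget INDEPENDENT of `#s` and of `D`.  This is the
arithmetic by which an exponential tree decay of conditional covariances (located, not printed for observables: header)
would discharge the clause (K12c) with a `K`-uniform `C_dec`. [folklore] -/
theorem rowSum_le_of_treeDecay {s : Finset ι} (dist : ι → ι → ℕ) (κ : ι → ι → ℝ) {A G₀ Γ θ ρ : ℝ} {D : ℕ} (p : ι)
    (hA : 0 ≤ A) (hG₀ : 0 ≤ G₀) (hΓ : 0 ≤ Γ) (hθ : 0 ≤ θ) (hκ : ∀ q ∈ s, κ p q ≤ A * θ ^ dist p q)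
    (hD : ∀ q ∈ s, dist p q ≤ D) (hG : ∀ n, n ≤ D → ((s.filter fun q => dist p q = n).card : ℝ) ≤ G₀ * Γ ^ n)
    (hρ : Γ * θ ≤ ρ) (hρ1 : ρ < 1) :
    ∑ q ∈ s, κ p q ≤ A * (G₀ / (1 - ρ)) := by
  have h1 : ∑ q ∈ s, κ p q ≤
      A * ∑ n ∈ range (D + 1), ((s.filter fun q => dist p q = n).card : ℝ) * θ ^ n :=
    rowSum_le_of_shellCount dist κ (fun n => θ ^ n) (fun n => ((s.filter fun q => dist p q = n).card : ℝ)) p hA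
      (fun n => pow_nonneg hθ n) hκ hD fun n _ => le_rfl
  have h2 : ∑ n ∈ range (D + 1), ((s.filter fun q => dist p q = n).card : ℝ) * θ ^ n ≤ G₀ / (1 - ρ) :=
    shellSum_le_of_geom D hG₀ hΓ hθ hG hρ hρ1
  exact h1.trans (mul_le_mul_of_nonneg_left h2 hA)

end Levels

/-! ## §3 (K12c–g′) The hypothesis shape and what it buys -/

section Shape

variable {Ω : Type*} [MeasurableSpace Ω] {ι : Type*} {μ : Measure Ω} {s : Finset ι} {X : ι → Ω → ℝ} {σ : ι → ℝ}
  {κ : ι → ι → ℝ} {C : ℝ}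

/-- **(K12c) HYPOTHESIS SHAPE `PairDecorrelation μ s X σ κ C`** — the cross-pair DECORRELATION clause NE1(ii)-DECORR /
O-G8 of `t4/T4-EST-O3Eii.md` §4, typed.  DATA: a law `μ` on `Ω` (cell: the conditional law of the scale-`k` fluctuation
field at a fixed exterior), a finite family `s` of real PIECES `X p` WITHOUT amplitudes (cell: the centred co-read pair
pieces alive in one cube), per-piece second-moment scales `σ p`, a DECORRELATION KERNEL `κ` on pairs of pieces and a
budget `C` (the cell's `C_dec`).  CLAUSES: `σ ≥ 0` and `κ ≥ 0` on `s`; COVARIANCE DOMINATION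
`|∫ X_p X_q dμ| ≤ κ(p,q)·σ_p·σ_q` (for centred pieces the left side is `|Cov(X_p, X_q)|`); the ℓ¹–ℓ^∞ (SCHUR) BUDGET: every
row sum and every column sum of `κ` over `s` is `≤ C`.  CONSEQUENCE (K12d): `∫(Σ_p c_pX_p)² dμ ≤ C·Σ_p (c_pσ_p)²` for all
amplitudes — the record's «Var_u(Σ_p c_p ℓ[B_p]) ≤ C_dec·Σ_p c_p²·Var_u(ℓ[B_p])» when `σ_p² = Var_u(ℓ[B_p])`.  CALIBRATION
(§4): the shape ALWAYS holds with `κ ≡ 1`, `C = #s` (`of_sup`, `of_cauchySchwarz`) and with `C = 1` for pairwise-orthogonal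
pieces (`of_uncorrelated`); its CONTENT for the cell is a `C` independent of `#s`, i.e. summable decay of `κ` in the
separation of the pairs (K12h) — the cluster expansion's tree decay at scale `k`, printed for the ACTIVITIES of the
expansion ([Balaban1988RG2Cluster] (2.38)–(2.41), header) and NOWHERE for pair insertions.  Nothing of it is asserted:
this is a HYPOTHESIS SHAPE. [folklore] -/
structure PairDecorrelation (μ : Measure Ω) (s : Finset ι) (X : ι → Ω → ℝ) (σ : ι → ℝ) (κ : ι → ι → ℝ)
    (C : ℝ) : Prop where
  σ_nonneg : ∀ p ∈ s, 0 ≤ σ p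
  κ_nonneg : ∀ p ∈ s, ∀ q ∈ s, 0 ≤ κ p q
  cov_le : ∀ p ∈ s, ∀ q ∈ s, |∫ ω, X p ω * X q ω ∂μ| ≤ κ p q * (σ p * σ q)
  row_le : ∀ p ∈ s, ∑ q ∈ s, κ p q ≤ C
  col_le : ∀ q ∈ s, ∑ p ∈ s, κ p q ≤ C

/-- (K12e₀) A bounded strongly measurable real function on a finite measure has an integrable square. [folklore] -/
theorem integrable_sq_of_abs_le [IsFiniteMeasure μ] {u : Ω → ℝ} (hum : AEStronglyMeasurable u μ) {bu : ℝ}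
    (hu : ∀ ω, |u ω| ≤ bu) : Integrable (fun ω => u ω ^ 2) μ :=
  integrable_of_abs_le (hum.pow 2) (C := bu ^ 2) fun ω => by
    rw [abs_pow]
    exact pow_le_pow_left₀ (abs_nonneg _) (hu ω) 2

/-- (K12e) Bounded strongly measurable pieces on a finite measure have integrable products. [folklore] -/
theorem integrable_mul_of_abs_le [IsFiniteMeasure μ] (hXm : ∀ p ∈ s, AEStronglyMeasurable (X p) μ) {b : ι → ℝ}
    (hXb : ∀ p ∈ s, ∀ ω, |X p ω| ≤ b p) {p q : ι} (hp : p ∈ s) (hq : q ∈ s) :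
    Integrable (fun ω => X p ω * X q ω) μ :=
  integrable_of_abs_le ((hXm p hp).mul (hXm q hq)) (C := b p * b q) fun ω => by
    rw [abs_mul]
    exact mul_le_mul (hXb p hp ω) (hXb q hq ω) (abs_nonneg _) ((abs_nonneg _).trans (hXb p hp ω))

/-- (K12k₀) CAUCHY–SCHWARZ for bounded strongly measurable real functions on a finite measure:
`|∫ f g dμ| ≤ √(∫ f² dμ)·√(∫ g² dμ)` (discriminant of `t ↦ ∫ (f − t g)² ≥ 0`). [folklore] -/
theorem abs_integral_mul_le_sqrt_mul_sqrt [IsFiniteMeasure μ] {f g : Ω → ℝ} (hfm : AEStronglyMeasurable f μ)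
    (hgm : AEStronglyMeasurable g μ) {bf bg : ℝ} (hf : ∀ ω, |f ω| ≤ bf) (hg : ∀ ω, |g ω| ≤ bg) :
    |∫ ω, f ω * g ω ∂μ| ≤ Real.sqrt (∫ ω, f ω ^ 2 ∂μ) * Real.sqrt (∫ ω, g ω ^ 2 ∂μ) := by
  have hf2 : Integrable (fun ω => f ω ^ 2) μ := integrable_sq_of_abs_le hfm hf
  have hg2 : Integrable (fun ω => g ω ^ 2) μ := integrable_sq_of_abs_le hgm hg
  have hfg : Integrable (fun ω => f ω * g ω) μ :=
    integrable_of_abs_le (hfm.mul hgm) (C := bf * bg) fun ω => by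
      rw [abs_mul]
      exact mul_le_mul (hf ω) (hg ω) (abs_nonneg _) ((abs_nonneg _).trans (hf ω))
  have hquad : ∀ t : ℝ,
      0 ≤ (∫ ω, g ω ^ 2 ∂μ) * (t * t) + (-(2 * ∫ ω, f ω * g ω ∂μ)) * t + ∫ ω, f ω ^ 2 ∂μ := by
    intro t
    have hnn : 0 ≤ ∫ ω, (f ω - t * g ω) ^ 2 ∂μ := integral_nonneg fun ω => sq_nonneg _
    have heq : (fun ω => (f ω - t * g ω) ^ 2) =
        fun ω => (f ω ^ 2 - 2 * t * (f ω * g ω)) + t ^ 2 * g ω ^ 2 := by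
      funext ω; ring
    have hF : Integrable (fun ω => f ω ^ 2 - 2 * t * (f ω * g ω)) μ := hf2.sub (hfg.const_mul _)
    have hG : Integrable (fun ω => t ^ 2 * g ω ^ 2) μ := hg2.const_mul _
    have hG' : Integrable (fun ω => 2 * t * (f ω * g ω)) μ := hfg.const_mul _
    rw [heq, integral_add hF hG, integral_sub hf2 hG', integral_const_mul, integral_const_mul] at hnn
    nlinarith [hnn]
  have hd := discrim_le_zero hquad
  rw [discrim] at hd
  have hA0 : 0 ≤ ∫ ω, f ω ^ 2 ∂μ := integral_nonneg fun ω => sq_nonneg _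
  have hP2 : (∫ ω, f ω * g ω ∂μ) ^ 2 ≤ (∫ ω, f ω ^ 2 ∂μ) * ∫ ω, g ω ^ 2 ∂μ := by nlinarith [hd]
  rw [← Real.sqrt_mul hA0, ← Real.sqrt_sq_eq_abs]
  exact Real.sqrt_le_sqrt hP2

namespace PairDecorrelation

/-- The budget of a nonempty family is nonnegative. [folklore] -/
theorem budget_nonneg (h : PairDecorrelation μ s X σ κ C) (hs : s.Nonempty) : 0 ≤ C := by
  obtain ⟨p, hp⟩ := hs
  exact (sum_nonneg fun q hq => h.κ_nonneg p hp q hq).trans (h.row_le p hp)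

/-- Monotonicity in the budget. [folklore] -/
theorem mono (h : PairDecorrelation μ s X σ κ C) {C' : ℝ} (hC : C ≤ C') : PairDecorrelation μ s X σ κ C' where
  σ_nonneg := h.σ_nonneg
  κ_nonneg := h.κ_nonneg
  cov_le := h.cov_le
  row_le p hp := (h.row_le p hp).trans hC
  col_le q hq := (h.col_le q hq).trans hC

/-- SYMMETRIC kernels (the case of a covariance domination): the column budget follows from the row budget. [folklore] -/
theorem of_symm (hσ : ∀ p ∈ s, 0 ≤ σ p) (hκ : ∀ p ∈ s, ∀ q ∈ s, 0 ≤ κ p q)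
    (hsymm : ∀ p ∈ s, ∀ q ∈ s, κ p q = κ q p)
    (hcov : ∀ p ∈ s, ∀ q ∈ s, |∫ ω, X p ω * X q ω ∂μ| ≤ κ p q * (σ p * σ q))
    (hrow : ∀ p ∈ s, ∑ q ∈ s, κ p q ≤ C) : PairDecorrelation μ s X σ κ C where
  σ_nonneg := hσ
  κ_nonneg := hκ
  cov_le := hcov
  row_le := hrow
  col_le q hq := (sum_congr rfl fun p hp => hsymm p hp q hq).trans_le (hrow q hq)

/-- Restriction to a sub-family keeps the budget (`κ ≥ 0`). [folklore] -/
theorem subset (h : PairDecorrelation μ s X σ κ C) {t : Finset ι} (hts : t ⊆ s) : PairDecorrelation μ t X σ κ C where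
  σ_nonneg p hp := h.σ_nonneg p (hts hp)
  κ_nonneg p hp q hq := h.κ_nonneg p (hts hp) q (hts hq)
  cov_le p hp q hq := h.cov_le p (hts hp) q (hts hq)
  row_le p hp :=
    (sum_le_sum_of_subset_of_nonneg hts fun q hq _ => h.κ_nonneg p (hts hp) q hq).trans (h.row_le p (hts hp))
  col_le q hq :=
    (sum_le_sum_of_subset_of_nonneg hts fun p hp _ => h.κ_nonneg p hp q (hts hq)).trans (h.col_le q (hts hq))

/-- **(K12d) SECOND MOMENT OF A SUM OF PAIR PIECES** under the shape: for all real amplitudes `c`,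
`∫ (Σ_{p ∈ s} c_p X_p)² dμ ≤ C·Σ_{p ∈ s} (c_p σ_p)²` — the DIAGONAL («variance») line times the decorrelation budget, in
place of the `#s`-fold larger squared sup line.  Integrability of the products `X_p X_q` is the honest binder (automatic
for bounded strongly measurable pieces on a finite measure, (K12e)). [folklore] -/
theorem integral_sq_sum_le (h : PairDecorrelation μ s X σ κ C)
    (hint : ∀ p ∈ s, ∀ q ∈ s, Integrable (fun ω => X p ω * X q ω) μ) (c : ι → ℝ) :
    ∫ ω, (∑ p ∈ s, c p * X p ω) ^ 2 ∂μ ≤ C * ∑ p ∈ s, (c p * σ p) ^ 2 := by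
  have hexp : ∀ ω, (∑ p ∈ s, c p * X p ω) ^ 2 = ∑ p ∈ s, ∑ q ∈ s, c p * c q * (X p ω * X q ω) :=
    fun ω => by
      rw [sq, sum_mul_sum]
      exact sum_congr rfl fun p _ => sum_congr rfl fun q _ => by ring
  have hI : ∫ ω, (∑ p ∈ s, c p * X p ω) ^ 2 ∂μ = ∑ p ∈ s, ∑ q ∈ s, c p * c q * ∫ ω, X p ω * X q ω ∂μ := by
    simp_rw [hexp]
    rw [integral_finsetSum _ fun p hp => integrable_finsetSum _ fun q hq => (hint p hp q hq).const_mul _]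
    refine sum_congr rfl fun p hp => ?_
    rw [integral_finsetSum _ fun q hq => (hint p hp q hq).const_mul _]
    exact sum_congr rfl fun q _ => integral_const_mul _ _
  rw [hI]
  exact sum_mul_mul_le_of_abs_le s (fun p q => ∫ ω, X p ω * X q ω ∂μ) κ c σ h.σ_nonneg h.κ_nonneg h.cov_le
    h.row_le h.col_le

/-- **(K12f) THE CLAUSE CHAINED WITH THE SECOND-CUMULANT BOOKING (K10).**  For a probability law `μ`, bounded strongly
measurable CENTRED pieces (`|X_p| ≤ b_p`, `∫ X_p dμ = 0` on `s`) and amplitudes with `Σ_{p ∈ s} |c_p|·b_p ≤ 1` (so that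
`V = Σ_p c_p X_p` is centred with `|V| ≤ 1`), the shape gives
`0 ≤ log ∫ exp(−Σ_p c_p X_p) dμ ≤ C·Σ_p (c_p σ_p)²`: the whole cube-family of pair pieces moves the effective action
`−log ∫ e^{−V} dμ` only at SECOND order, along the DIAGONAL line, up to the decorrelation budget `C`
(`T4CoReadMoment.log_integral_exp_neg_nonneg` / `log_integral_exp_neg_le_sq` + (K12d)). [folklore] -/
theorem log_integral_exp_neg_sum_bounds [IsProbabilityMeasure μ] (h : PairDecorrelation μ s X σ κ C)
    (hXm : ∀ p ∈ s, AEStronglyMeasurable (X p) μ) {b : ι → ℝ} (hXb : ∀ p ∈ s, ∀ ω, |X p ω| ≤ b p)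
    (hX0 : ∀ p ∈ s, ∫ ω, X p ω ∂μ = 0) {c : ι → ℝ} (hc : ∑ p ∈ s, |c p| * b p ≤ 1) :
    0 ≤ Real.log (∫ ω, Real.exp (-∑ p ∈ s, c p * X p ω) ∂μ) ∧
      Real.log (∫ ω, Real.exp (-∑ p ∈ s, c p * X p ω) ∂μ) ≤ C * ∑ p ∈ s, (c p * σ p) ^ 2 := by
  have hVm : AEStronglyMeasurable (fun ω => ∑ p ∈ s, c p * X p ω) μ :=
    Finset.aestronglyMeasurable_fun_sum s fun p hp => (hXm p hp).const_mul (c p)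
  have hVb : ∀ ω, |∑ p ∈ s, c p * X p ω| ≤ 1 := fun ω =>
    (abs_sum_le_sum_abs _ _).trans ((sum_le_sum fun p hp => by
      rw [abs_mul]
      exact mul_le_mul_of_nonneg_left (hXb p hp ω) (abs_nonneg _)).trans hc)
  have hV0 : ∫ ω, ∑ p ∈ s, c p * X p ω ∂μ = 0 := by
    rw [integral_finsetSum _ fun p hp => (integrable_of_abs_le (hXm p hp) (hXb p hp)).const_mul (c p)]
    exact sum_eq_zero fun p hp => by rw [integral_const_mul, hX0 p hp, mul_zero]
  exact ⟨log_integral_exp_neg_nonneg hVm hVb hV0,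
    (log_integral_exp_neg_le_sq hVm hVb hV0).trans
      (h.integral_sq_sum_le (fun p hp q hq => integrable_mul_of_abs_le hXm hXb hp hq) c)⟩

/-- **(K12g′) HEADLINE — THE CUBE-FAMILY OF PAIR PIECES ON THE VARIANCE LINE, UP TO `C_dec`.**  Under the shape with
budget `C ≥ 0`, bounded strongly measurable centred pieces with `Σ|c_p|b_p ≤ 1`, birth levels `lvl p ≤ k ≤ K`,
second-moment budgets `(c_pσ_p)² ≤ A(τ²)^{K − lvl p}` and positional fibre counts `#{p : lvl p = j} ≤ N₀Λ^{k−j}` with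
`Λτ² ≤ r < 1`: `0 ≤ log ∫ exp(−Σ_p c_pX_p) dμ ≤ C·N₀A/(1−r)` — K-UNIFORM.  With `C = C_dec` independent of `#s` this is the
record's «with it the diagonal VARIANCE LINE is the bound»; with the calibration value `C = #s` of §4 it is the squared sup
line, unbounded in `K`. ((K12f) + (K12g).) [folklore] -/
theorem log_integral_exp_neg_sum_le_line [IsProbabilityMeasure μ] (h : PairDecorrelation μ s X σ κ C) (hC : 0 ≤ C)
    (hXm : ∀ p ∈ s, AEStronglyMeasurable (X p) μ) {b : ι → ℝ} (hXb : ∀ p ∈ s, ∀ ω, |X p ω| ≤ b p)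
    (hX0 : ∀ p ∈ s, ∫ ω, X p ω ∂μ = 0) {c : ι → ℝ} (hc : ∑ p ∈ s, |c p| * b p ≤ 1)
    (lvl : ι → ℕ) {N₀ A Λ τ r : ℝ} {K k : ℕ} (hk : k ≤ K) (hlvl : ∀ p ∈ s, lvl p ≤ k)
    (hcard : ∀ j, j ≤ k → ((s.filter fun p => lvl p = j).card : ℝ) ≤ N₀ * Λ ^ (k - j))
    (hN₀ : 0 ≤ N₀) (hA : 0 ≤ A) (hΛ : 0 ≤ Λ) (hτ0 : 0 ≤ τ) (hτ1 : τ ≤ 1) (hr : Λ * τ ^ 2 ≤ r) (hr1 : r < 1)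
    (hw : ∀ p ∈ s, (c p * σ p) ^ 2 ≤ A * (τ ^ 2) ^ (K - lvl p)) :
    0 ≤ Real.log (∫ ω, Real.exp (-∑ p ∈ s, c p * X p ω) ∂μ) ∧
      Real.log (∫ ω, Real.exp (-∑ p ∈ s, c p * X p ω) ∂μ) ≤ C * (N₀ * A / (1 - r)) := by
  obtain ⟨h0, h1⟩ := h.log_integral_exp_neg_sum_bounds hXm hXb hX0 hc
  exact ⟨h0, h1.trans (mul_le_mul_of_nonneg_left
    (cubeBudget_le lvl hk hlvl hcard hN₀ hA hΛ hτ0 hτ1 hr hr1 hw) hC)⟩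

/-! ## §4 (K12i–k) Calibration: what the shape is WITHOUT any decorrelation -/

/-- **(K12i) CALIBRATION 1 — THE SQUARED SUP LINE.**  On a probability space, pieces with `|X_p| ≤ b_p` (`b ≥ 0` on `s`)
ALWAYS satisfy the shape with the trivial kernel `κ ≡ 1`, scales `σ = b` and budget `C = #s`: no measurability, no
centring, no decay.  Hence (K12d) without decorrelation reads `∫(Σ c_pX_p)² ≤ #s·Σ(c_pb_p)²` — the squared sup line,
whose budget grows with the number of pairs in the cube. [folklore] -/
theorem of_sup [IsProbabilityMeasure μ] {b : ι → ℝ} (hb : ∀ p ∈ s, 0 ≤ b p) (hXb : ∀ p ∈ s, ∀ ω, |X p ω| ≤ b p) :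
    PairDecorrelation μ s X b (fun _ _ => 1) (s.card : ℝ) where
  σ_nonneg := hb
  κ_nonneg _ _ _ _ := zero_le_one
  cov_le p hp q hq := by
    rw [one_mul]
    calc |∫ ω, X p ω * X q ω ∂μ| ≤ ∫ ω, |X p ω * X q ω| ∂μ := abs_integral_le_integral_abs
      _ ≤ ∫ _ω, b p * b q ∂μ :=
          integral_mono_of_nonneg (Filter.Eventually.of_forall fun ω => abs_nonneg _) (integrable_const _)
            (Filter.Eventually.of_forall fun ω => by
              show |X p ω * X q ω| ≤ b p * b q
              rw [abs_mul]
              exact mul_le_mul (hXb p hp ω) (hXb q hq ω) (abs_nonneg _) (hb p hp))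
      _ = b p * b q := by simp
  row_le p hp := by simp
  col_le q hq := by simp

/-- **(K12j) CALIBRATION 2 — PAIRWISE-ORTHOGONAL PIECES** (`∫ X_p X_q dμ = 0` for `p ≠ q` in `s`, diagonal second moments
`≤ σ_p²`): the shape holds with `κ = δ_{pq}` and the OPTIMAL budget `C = 1`. [folklore] -/
theorem of_uncorrelated [DecidableEq ι] (hσ : ∀ p ∈ s, 0 ≤ σ p)
    (horth : ∀ p ∈ s, ∀ q ∈ s, p ≠ q → ∫ ω, X p ω * X q ω ∂μ = 0)
    (hdiag : ∀ p ∈ s, |∫ ω, X p ω * X p ω ∂μ| ≤ σ p * σ p) :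
    PairDecorrelation μ s X σ (fun p q => if p = q then 1 else 0) 1 where
  σ_nonneg := hσ
  κ_nonneg p _ q _ := by
    show 0 ≤ (if p = q then (1 : ℝ) else 0)
    split_ifs <;> norm_num
  cov_le p hp q hq := by
    by_cases hpq : p = q
    · subst hpq
      simpa using hdiag p hp
    · show |∫ ω, X p ω * X q ω ∂μ| ≤ (if p = q then (1 : ℝ) else 0) * (σ p * σ q)
      rw [horth p hp q hq hpq, if_neg hpq]
      simp
  row_le p hp := by simp [hp]
  col_le q hq := by simp [hq]

/-- **(K12k) CALIBRATION 3 — CAUCHY–SCHWARZ.**  On a finite measure, bounded strongly measurable pieces ALWAYS satisfy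
the shape with the LITERAL second-moment scales `σ_p = √∫X_p² dμ`, the trivial kernel `κ ≡ 1` and the budget `C = #s`
((K12k₀)).  So with `σ_p² =` the second moment, the clause's only content is the replacement of `#s` by a `K`-uniform
`C_dec` — summable decay of the normalised covariances in the separation, (K12h″). [folklore] -/
theorem of_cauchySchwarz [IsFiniteMeasure μ] (hXm : ∀ p ∈ s, AEStronglyMeasurable (X p) μ) {b : ι → ℝ}
    (hXb : ∀ p ∈ s, ∀ ω, |X p ω| ≤ b p) :
    PairDecorrelation μ s X (fun p => Real.sqrt (∫ ω, X p ω ^ 2 ∂μ)) (fun _ _ => 1) (s.card : ℝ) where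
  σ_nonneg p _ := Real.sqrt_nonneg _
  κ_nonneg _ _ _ _ := zero_le_one
  cov_le p hp q hq := by
    rw [one_mul]
    exact abs_integral_mul_le_sqrt_mul_sqrt (hXm p hp) (hXm q hq) (hXb p hp) (hXb q hq)
  row_le p hp := by simp
  col_le q hq := by simp

end PairDecorrelation

end Shape

end Literature.MathematicalPhysics.QuantumFieldTheory.Balaban1983to89.T4PairDecorrelation

end
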